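import Literature.NumberTheory.EllipticCurves.Tian2014.CMPointSystemDescentPrimeFive
import HarnessLib

/-!
# Tian 2014 Thm. 4.1 at `k = 1` (= Monsky 1990 Thm. 3.9 (5), the case `p₁p₅` with `(p₁/p₅) = −1`) transplanted onto
# the `n ≡ 1 (mod 4)` CM-point system: the trace points `y_d = Tr_{H/K(√d)} z`, Lemma 4.3's relation (4.3) at `k = 1`,
# and the descent `y_n ∉ 2E(ℚ(√n))⁻ + E[2]` from the printed system + Tian's printed divisibility sentence for `y_{p₀}`

Cell `bsd-monsky` (prover-A seat, g14; `run/shared/lean/pub/bsd-monsky/`). HONEST FRAMING (README §1): nothing is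
asserted about BSD, nothing is booked, no `_holds`, no named fact; this file PROVES theorems on the data
`D : CMPointDataOne n` (Tian's Thm. 2.4 system) with its printed properties as hypotheses. NOTHING NEW ON PAPER: Tian
proves Thm. 4.1 in print by induction on `k`; this is the FIRST STEP `k = 1` of that induction (`n = p₀p₁`, `p₀ ≡ 5`,
`p₁ ≡ 1 (mod 8)`), which is Monsky's Cor. 5.15 (3) «`p₁p₅` when `(p₁/p₅) = −1`» (Thm. 3.9 (5)), transplanted onto Tian's
point. The one ANALYTIC input of Tian's step — "by induction hypothesis and Theorem 3.3, we know that `y_d ∈ 2^k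
E(ℚ(√d))⁻ + E[2]`" (Thm. 3.3: the comparison of `P_χ(f)` and `P_{χ₀}(f)` through Kolyvagin, the generalised Gross–Zagier
formula and `2`-adic valuations of special `L`-values) — is taken as the BINDER `hDiv` on the point `y_{p₀}` of the
`n`-system: "`y_{p₀} ∈ 2E(ℚ(√p₀))⁻ + E[2]`". Everything else is the printed skeleton: Thm. 2.4, Def. 2.3, the genus
sentences of §4.1 on `√p₀`, `√p₁` (`2𝒜 ≅ Gal(H/H₀)`, `σ_ϖ√p₀ = −√p₀`, `σ_ϖ√p₁ = √p₁`), "`i ∉ H`"; "`2𝒜` odd" (Tian's (1.1)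
at `k = 1`, the graph condition `(p₁/p₀) = −1`) and "`#𝒜[2] = 4`" are KERNEL THEOREMS (Rédei–Reichardt, Gauss).

## Source (verbatim, arXiv:1210.8231)

* Thm. 4.1 (p0019 L65–L70): "Let `k ≥ 0` be an integer and `n = p₀p₁⋯p_k` a product of distinct primes with `p₀ ≡ 5 mod 8`
  and `p₁, ⋯, p_k ≡ 1 mod 8`. Then the point `y_n := Tr_{H/K(√n)} z` is actually defined over `ℚ(√n)` and belongs to
  `2^{k−1}E(ℚ(√n))⁻ + E[2]`. Moreover, the point `y_n ∉ 2^k E(ℚ(√n))⁻ + E[2]` if the ideal class group of `K = ℚ(√−2n)`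
  does not contain order `4` elements."
* p0020 L24–L30: "For each positive divisor `d` of `n` divisible by `p₀`, define `y_d := Tr_{H/K(√d)} z ∈ E(K(√d))`. Define
  `y₀ = Tr_{H/H₀} z ∈ E(H₀)`." Lemma 4.3 (p0020 L31–L44): "(1) the point `y_d ∈ E(ℚ(√d))⁻` for each `d` with `p₀ | d | n`.
  (2) the point `y₀ ∈ E(H₀⁺)` … satisfies: (4.2) `y₀ + y₀^{σ_ϖ} = #2𝒜·(0, 0)`. Moreover these points satisfy the following
  relation: (4.3) `Σ_{p₀|d|n} y_d = 2^k y₀` if `k ≥ 2`, `2^k y₀ + #2𝒜·(0, 0)` if `k = 1`."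
* Lemma 4.3 proof (p0020 L58–L61): "Note that `σ_ϖ(√p₀) = −√p₀` and `σ_ϖ√p_i = √p_i` for all `1 ≤ i ≤ k`."
* Proof of Thm. 4.1 (p0021 L49–L70): "We do induction on `k`. It holds when `k = 0` by Proposition 4.1 [4.2]. Now assume
  `k ≥ 1`. By Lemma 4.2 [4.3], we now have `y_n + Σ_{p₀|d|n, d≠n} y_d = 2^k y₀ mod E[2]` (4.4). For each `d` with `p₀|d|n`,
  `d ≠ n`, let `y_d⁰` be the point constructed similarly with `ℚ(√−2n)` replaced by `ℚ(√−2d)`. Then `4y_d`, `4y_d⁰` are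
  `P_χ(f)` and `P_{χ⁰}(f)` in section 3, respectively. … By induction hypothesis and Theorem 3.3, we know that
  `y_d ∈ 2^k E(ℚ(√d))⁻ + E[2]`." (p0022 L4–L20): "Now assume that the ideal class group of `K = ℚ(√−2n)` has no order `4`
  element. Suppose that `y_n = 2^k y′_n + t_n` for some `y′_n ∈ E(ℚ(√n))⁻` and `t_n ∈ E[2]`. Then by the relation (4.3) in
  Lemma 4.2, we have that `2^k(y₀ − Σ_{p₀|d|n} y′_d) ∈ E[2]`, with `y₀ − Σ y′_d ∈ E(H₀⁺)`. Again, any proper sub-extension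
  of `H₀⁺/ℚ` must be ramified at some odd prime, we have that `y₀ − Σ y′_d = t` for some `t ∈ E[2]`. Thus `y₀ + y₀^{σ_ϖ}
  = Σ(y′_d + y′_d^{σ_ϖ}) + (t + t^{σ_ϖ}) = 0`. But `y₀ + y₀^{σ_ϖ} = (0, 0) ∈ E[2]` by the equality (4.2) in Lemma 4.2. It
  is a contradiction." (At `k = 1` the ramification sentence is not needed: `2(y₀ − Σ y′_d) ∈ E[2]` puts `y₀ − Σ y′_d` in
  `E(H)[4] = E[2]`, which "`i ∉ H`" gives on coordinates.)

## What is proved here (kernel), and from what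

* §1 the stabiliser finsets `B_θ = {s ∈ 𝒜 : σ_s θ = θ}` (`Gal(H/K(θ))` through the Artin map) and the trace points
  `y_θ = Σ_{s ∈ B_θ} z_s` (Tian's `y_d`, `d = θ²`): subgroup facts; when some `π` moves `θ`, the complement of `B_θ` is the
  coset `π·B_θ` and `#𝒜 = 2·#B_θ`; `σ_s(y_θ) = y_θ` (`s ∈ B_θ`), `conj(y_θ) = y_θ`, `σ_s(y_θ) = #B_θ·(0,0) − y_θ` (`s ∉ B_θ`);
  `y_θ ∈ E(ℚ(θ))⁻` when `#B_θ` is even (Lemma 4.3 (1)) — Galois descent as in the one-prime file.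
* §2 `n = p₀p₁`: `B_{√p₀} ∩ B_{√n} = 2𝒜` (the genus sentence), `B_{√n} ∖ 2𝒜 = [ϖ]·(B_{√p₀} ∖ 2𝒜)`, and **(4.3) at `k = 1`**:
  `y_{p₀} + y_n = 2y₀ + (0, 0)` (`#(B_{√p₀} ∖ 2𝒜) = #(2𝒜)` odd).
* §3 `K = ℚ(√−2p₀p₁)`: `#𝒜[2] = 4` (Gauss, `t = 3`), `#(2𝒜)` odd (Tian's (1.1) at `k = 1`: `condition11_caseFive` with the
  graph condition from `(p₁/p₀) = −1` and quadratic reciprocity), `#𝒜 = 4·#(2𝒜)`.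
* §4 THE DESCENT (Thm. 4.1 at `k = 1`): with `hDiv : y_{p₀} = 2S′ + T′` (`S′` a transfer image along `√p₀`, `2T′ = 0`), if
  `y_n = 2S + T` then `Q := y₀ − S − S′` has `4Q = 0`, so `2Q = 0`; `σ_{[ϖ]}` fixes `Q`, negates `S` and `S′` (it moves `√n`
  and `√p₀`) and sends `y₀` to `(0,0) − y₀` — whence `(0,0) = 2Q = 0`, contradiction.

[cite: Tian2014, Thm. 4.1 (arXiv:1210.8231 p0019 L65–L70), Lemma 4.3 and its proof (p0020 L24–p0021 L48), proof of Thm. 4.1 (p0021 L49–p0022 L20), Thm. 3.3 (p0014 L99–L105), Lemma 5.1 (p. 28)]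
[cite: Monsky1990MockHeegner, Thm. 3.9 (5) (p. 55), Lemma 3.7 (3) (pp. 53–54), Cor. 5.15 (3) (p. 66)] [cite: Cox2013, Prop. 3.11] [cite: LiMa2008, Thm. 0.4]
-/

noncomputable section

open scoped Classical

open Matrix WeierstrassCurve NumberField Literature.NumberTheory.EllipticCurves
  Literature.NumberTheory.EllipticCurves.TianYuanZhang2017
  Literature.NumberTheory.EllipticCurves.HeathBrown1994
  Literature.NumberTheory.QuadraticFields.RedeiReichardt
open Literature.NumberTheory.EllipticCurves.Monsky1990 (map_sub_self_eq_zero_of_two_nsmul_eq_zero)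

set_option autoImplicit false

namespace Literature.NumberTheory.EllipticCurves.Tian2014

/-! ## §0 Square roots of naturals in a field of characteristic `0` (plumbing for the transfers) -/

section SqrtPlumbing

variable {H : Type} [Field H] [CharZero H]

/-- A square root of `N ≠ 0` is non-zero. [cite: Tian2014, (4.1) (p0019 L61: K(√n))] [folklore] -/
theorem ne_zero_of_sq_eq_natCast' {N : ℕ} (hN : N ≠ 0) {θ : H} (hθ : θ ^ 2 = (N : H)) : θ ≠ 0 := by
  intro h
  rw [h, zero_pow two_ne_zero, eq_comm, Nat.cast_eq_zero] at hθ
  exact hN hθ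

/-- A square root of `N` squares to the image of `N ∈ ℚ`. [cite: Tian2014, (4.1) (p0019 L61)] [folklore] -/
theorem sq_eq_algebraMap_of_sq_eq_natCast' {N : ℕ} {θ : H} (hθ : θ ^ 2 = (N : H)) :
    θ ^ 2 = algebraMap ℚ H (N : ℚ) := by
  rw [hθ, map_natCast]

omit [CharZero H] in
/-- `(θ₀θ₁)² = p₀p₁`. [cite: Tian2014, (4.1) (p0019 L61: √n = √p₀⋯√p_k)] [folklore] -/
theorem mul_sq_eq_natCast {p₀ p₁ : ℕ} {θ₀ θ₁ : H} (h₀ : θ₀ ^ 2 = (p₀ : H)) (h₁ : θ₁ ^ 2 = (p₁ : H)) :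
    (θ₀ * θ₁) ^ 2 = ((p₀ * p₁ : ℕ) : H) := by
  rw [mul_pow, h₀, h₁, Nat.cast_mul]

end SqrtPlumbing

namespace CMPointDataOne

variable {n : ℕ}

/-! ## §1 The stabiliser finsets `B_θ` and the trace points `y_θ = Σ_{s ∈ B_θ} z_s` -/

/-- **The stabiliser `B_θ = {s ∈ 𝒜 : σ_s θ = θ}`** of an element `θ ∈ H` under the Artin action — `Gal(H/K(θ)) ∩ Gal(H/K)`
read on `𝒜` ("`Gal(H/K(√d))`", Lemma 4.3). [cite: Tian2014, p0020 L24–L29, Lemma 4.3 (p0020 L31–L44)] -/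
def stabFinset (D : CMPointDataOne n) (θ : D.H) : Finset (ClassGroup (𝓞 (GenusField (2 * n)))) :=
  Finset.univ.filter fun s => D.art s θ = θ

/-- **The trace point `y_θ := Σ_{s ∈ B_θ} z_s`** — Tian's `y_d = Tr_{H/K(√d)} z` for `θ = √d` (`d = θ²`), `p₀ | d | n`.
[cite: Tian2014, (4.1) (p0019 L61), p0020 L24–L29] -/
def yTrace (D : CMPointDataOne n) (θ : D.H) : EPoint D.H :=
  ∑ s ∈ D.stabFinset θ, D.z s

/-- **The transfer `E_N(ℚ) →+ E(H)` along a square root `θ ∈ H` of `N`** (the data's `transferPos` for a divisor `N` of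
`n`: "`E(ℚ(√d))⁻ ≅ E^{(d)}(ℚ)`"). [cite: Tian2014, Lemma 4.3 (1) (p0020 L33–L34), Thm. 1.5 (p0003 L25–L27)] -/
def transferAlong (D : CMPointDataOne n) (N : ℕ) (hN : N ≠ 0) {θ : D.H} (hθ : θ ^ 2 = (N : D.H)) :
    (congruentNumberCurve N).toAffine.Point →+ EPoint D.H :=
  transferEPos N θ (sq_eq_algebraMap_of_sq_eq_natCast' hθ) (ne_zero_of_sq_eq_natCast' hN hθ)

section Stab

variable (D : CMPointDataOne n) {θ : D.H}

/-- Membership in `B_θ`. [cite: Tian2014, Lemma 4.3 (p0020 L31–L44)] [folklore] -/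
theorem mem_stabFinset_iff (s : ClassGroup (𝓞 (GenusField (2 * n)))) :
    s ∈ D.stabFinset θ ↔ D.art s θ = θ := by
  simp [stabFinset]

/-- `B_θ` is closed under multiplication. [cite: Tian2014, Lemma 4.3 (p0020 L31–L44)] [folklore] -/
theorem mul_mem_stabFinset {s t : ClassGroup (𝓞 (GenusField (2 * n)))} (hs : s ∈ D.stabFinset θ)
    (ht : t ∈ D.stabFinset θ) : s * t ∈ D.stabFinset θ := by
  rw [mem_stabFinset_iff] at *
  rw [map_mul, AlgEquiv.mul_apply, ht, hs]

/-- `B_θ` is closed under inversion. [cite: Tian2014, Lemma 4.3 (p0020 L31–L44)] [folklore] -/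
theorem inv_mem_stabFinset {s : ClassGroup (𝓞 (GenusField (2 * n)))} (hs : s ∈ D.stabFinset θ) :
    s⁻¹ ∈ D.stabFinset θ := by
  rw [mem_stabFinset_iff] at *
  have := congrArg (D.art s⁻¹) hs
  rwa [← AlgEquiv.mul_apply, ← map_mul, inv_mul_cancel, map_one, AlgEquiv.one_apply, eq_comm] at this

/-- `s·B_θ = B_θ` for `s ∈ B_θ`. [cite: Tian2014, Lemma 4.3 (p0020 L31–L44)] [folklore] -/
theorem image_mul_stabFinset_of_mem {s : ClassGroup (𝓞 (GenusField (2 * n)))} (hs : s ∈ D.stabFinset θ) :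
    (D.stabFinset θ).image (fun t => s * t) = D.stabFinset θ := by
  ext x
  simp only [Finset.mem_image]
  constructor
  · rintro ⟨t, ht, rfl⟩
    exact D.mul_mem_stabFinset hs ht
  · intro hx
    exact ⟨s⁻¹ * x, D.mul_mem_stabFinset (D.inv_mem_stabFinset hs) hx, by rw [mul_inv_cancel_left]⟩

/-- `B_θ⁻¹ = B_θ`. [cite: Tian2014, Prop. 4.2 proof (p0020 L5–L9: "stable under this action")] [folklore] -/
theorem image_inv_stabFinset : (D.stabFinset θ).image (fun t => t⁻¹) = D.stabFinset θ := by
  ext x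
  simp only [Finset.mem_image]
  constructor
  · rintro ⟨t, ht, rfl⟩
    exact D.inv_mem_stabFinset ht
  · intro hx
    exact ⟨x⁻¹, D.inv_mem_stabFinset hx, inv_inv x⟩

variable {N : ℕ} (hN : N ≠ 0) (hθ : θ ^ 2 = (N : D.H))
include hN hθ

omit hN in
/-- An Artin automorphism sends `θ = √N` to `±θ`. [cite: Tian2014, Lemma 4.3 proof (p0020 L58–L61)] [folklore] -/
theorem art_sq_eq_or_eq_neg (s : ClassGroup (𝓞 (GenusField (2 * n)))) :
    D.art s θ = θ ∨ D.art s θ = -θ :=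
  gal_sqrt_pos_eq_or_eq_neg N θ (sq_eq_algebraMap_of_sq_eq_natCast' hθ) (D.art s)

/-- `θ ≠ −θ` (characteristic `0`, `N ≠ 0`). [cite: Tian2014, (4.1) (p0019 L61)] [folklore] -/
theorem sq_ne_neg_self : θ ≠ -θ := by
  intro h
  apply ne_zero_of_sq_eq_natCast' hN hθ
  have : (2 : D.H) * θ = 0 := by linear_combination h
  rcases mul_eq_zero.mp this with h2 | h2
  · exact absurd h2 two_ne_zero
  · exact h2

variable {π : ClassGroup (𝓞 (GenusField (2 * n)))} (hπ : D.art π θ = -θ)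
include hπ

/-- **When `π` moves `θ`: `π·s ∈ B_θ ⟺ s ∉ B_θ`** — the complement of `B_θ` is the coset `π·B_θ`.
[cite: Tian2014, Lemma 4.3 proof (p0020 L58–L61: σ_ϖ(√p₀) = −√p₀)] [folklore] -/
theorem mul_mem_stabFinset_iff_not_mem (s : ClassGroup (𝓞 (GenusField (2 * n)))) :
    π * s ∈ D.stabFinset θ ↔ s ∉ D.stabFinset θ := by
  rw [mem_stabFinset_iff, mem_stabFinset_iff, map_mul, AlgEquiv.mul_apply]
  rcases D.art_sq_eq_or_eq_neg hθ s with h | h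
  · rw [h, hπ]
    exact ⟨fun e => absurd e.symm (D.sq_ne_neg_self hN hθ), fun e => absurd rfl e⟩
  · rw [h, map_neg, hπ, neg_neg]
    exact ⟨fun _ e => D.sq_ne_neg_self hN hθ e.symm, fun _ => rfl⟩

/-- `s·B_θ = π·B_θ` for `s ∉ B_θ` (`π² = 1`). [cite: Tian2014, Lemma 4.3 proof (p0020 L58–L61)] [folklore] -/
theorem image_mul_stabFinset_eq_of_not_mem (hπ2 : π * π = 1) {s : ClassGroup (𝓞 (GenusField (2 * n)))}
    (hs : s ∉ D.stabFinset θ) :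
    (D.stabFinset θ).image (fun t => s * t) = (D.stabFinset θ).image (fun t => π * t) := by
  have hmem : π * s ∈ D.stabFinset θ := (D.mul_mem_stabFinset_iff_not_mem hN hθ hπ s).mpr hs
  have hs' : s = π * (π * s) := by rw [← mul_assoc, hπ2, one_mul]
  conv_lhs => rw [hs']
  rw [show (fun t => π * (π * s) * t) = (fun t => π * t) ∘ (fun t => (π * s) * t) from by
    funext t; simp [mul_assoc], ← Finset.image_image, D.image_mul_stabFinset_of_mem hmem]

/-- **`#𝒜 = 2·#B_θ`** when some `π` of order `2` moves `θ`: `𝒜 = B_θ ⊔ π·B_θ`. [cite: Tian2014, Lemma 4.3 proof (p0020 L52–L58)] [folklore] -/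
theorem natCard_eq_two_mul_card_stabFinset (hπ2 : π * π = 1) :
    Nat.card (ClassGroup (𝓞 (GenusField (2 * n)))) = 2 * (D.stabFinset θ).card := by
  have hdisj : Disjoint (D.stabFinset θ) ((D.stabFinset θ).image fun t => π * t) := by
    rw [Finset.disjoint_left]
    intro x hx hx'
    obtain ⟨t, ht, rfl⟩ := Finset.mem_image.mp hx'
    exact (D.mul_mem_stabFinset_iff_not_mem hN hθ hπ t).mp hx ht
  have hunion : (Finset.univ : Finset (ClassGroup (𝓞 (GenusField (2 * n))))) =
      D.stabFinset θ ∪ (D.stabFinset θ).image (fun t => π * t) := by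
    ext x
    simp only [Finset.mem_univ, true_iff, Finset.mem_union, Finset.mem_image]
    by_cases hx : x ∈ D.stabFinset θ
    · exact Or.inl hx
    · refine Or.inr ⟨π * x, (D.mul_mem_stabFinset_iff_not_mem hN hθ hπ x).mpr hx, ?_⟩
      rw [← mul_assoc, hπ2, one_mul]
  have hinj : Set.InjOn (fun t => π * t) ((D.stabFinset θ : Finset _) : Set _) :=
    fun a _ b _ hab => mul_left_cancel hab
  rw [Nat.card_eq_fintype_card, ← Finset.card_univ, hunion, Finset.card_union_of_disjoint hdisj,
    Finset.card_image_of_injOn hinj]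
  omega

end Stab

/-! ## §1b The trace points under `σ_s` and complex conjugation; `y_θ ∈ E(ℚ(θ))⁻` (Lemma 4.3 (1)) -/

section Traces

variable (D : CMPointDataOne n) {θ : D.H}

/-- `σ_s(y_θ) = y_θ` for `s ∈ B_θ` (`σ_s` permutes the summands). [cite: Tian2014, Lemma 4.3 proof (p0020 L45–L48)] -/
theorem act_art_yTrace_of_mem (h23 : D.def23) {s : ClassGroup (𝓞 (GenusField (2 * n)))}
    (hs : s ∈ D.stabFinset θ) : D.act (D.art s) (D.yTrace θ) = D.yTrace θ := by
  unfold yTrace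
  rw [map_sum, Finset.sum_congr rfl (fun t _ => h23 s t)]
  conv_rhs => rw [← D.image_mul_stabFinset_of_mem hs]
  rw [Finset.sum_image (fun a _ b _ hab => mul_left_cancel hab)]

/-- **Complex conjugation fixes `y_θ`** (Thm. 2.4 (2) sends `z_t` to `z_{t⁻¹}`; `B_θ` is inverse-stable).
[cite: Tian2014, Lemma 4.3 proof (p0020 L45–L48), Thm. 2.4 (2) (p0008 L73)] -/
theorem act_conj_yTrace (h2 : D.thm24_2) : D.act D.conj (D.yTrace θ) = D.yTrace θ := by
  unfold yTrace
  rw [map_sum, Finset.sum_congr rfl (fun t _ => h2 t)]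
  conv_rhs => rw [← D.image_inv_stabFinset (θ := θ)]
  rw [Finset.sum_image (fun a _ b _ hab => inv_injective hab)]

/-- **`σ_s(y_θ) = #B_θ·(0, 0) − y_θ` for `s ∉ B_θ`** ("`y_d + y_d^{σ_ϖ} = #Gal(H/K(√d))·(0, 0)`", Lemma 4.3 proof): `s·B_θ =
[ϖ]·B_θ` and Thm. 2.4 (3). [cite: Tian2014, Lemma 4.3 proof (p0020 L52–L57), Thm. 2.4 (3) (p0008 L74)] -/
theorem act_art_yTrace_of_not_mem {N : ℕ} (hN : N ≠ 0) (hθ : θ ^ 2 = (N : D.H)) (hn8 : n % 8 = 5)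
    (h3 : D.thm24_3) (h23 : D.def23) (hπ : D.art D.piClass θ = -θ) (hπ2 : D.piClass * D.piClass = 1)
    {s : ClassGroup (𝓞 (GenusField (2 * n)))} (hs : s ∉ D.stabFinset θ) :
    D.act (D.art s) (D.yTrace θ) = (D.stabFinset θ).card • ptZero - D.yTrace θ := by
  have h3' : ∀ t, D.z (D.piClass * t) = ptZero - D.z t := by
    intro t
    have := h3 t
    rw [if_pos hn8] at this
    rw [← this]; abel
  unfold yTrace
  rw [map_sum, Finset.sum_congr rfl (fun t _ => h23 s t),
    ← Finset.sum_image (f := D.z) (g := fun t => s * t) (fun a _ b _ hab => mul_left_cancel hab),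
    D.image_mul_stabFinset_eq_of_not_mem hN hθ hπ hπ2 hs,
    Finset.sum_image (f := D.z) (g := fun t => D.piClass * t) (fun a _ b _ hab => mul_left_cancel hab),
    Finset.sum_congr rfl (fun t _ => h3' t), Finset.sum_sub_distrib, Finset.sum_const]

/-- **`y_θ ∈ E(ℚ(θ))⁻` when `#B_θ` is even (Lemma 4.3 (1))**: `y_θ` is fixed by `σ_s` (`s ∈ B_θ`) and by complex conjugation
(which fixes the real `θ`), and negated by `σ_s` (`s ∉ B_θ`, which moves `θ`): the automorphisms acting on `(θ, y_θ)` by a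
common sign form a subgroup containing the generators; Galois descent. [cite: Tian2014, Lemma 4.3 (1) and its proof (p0020 L33–L57)] -/
theorem exists_transferAlong_eq_yTrace {N : ℕ} (hN : N ≠ 0) (hθ : θ ^ 2 = (N : D.H)) (hn8 : n % 8 = 5)
    (h3 : D.thm24_3) (h23 : D.def23) (hπ : D.art D.piClass θ = -θ) (hP : D.Printed) (hconjθ : D.conj θ = θ)
    (heven : Even (D.stabFinset θ).card) :
    ∃ y' : (congruentNumberCurve N).toAffine.Point, D.transferAlong N hN hθ y' = D.yTrace θ := by
  obtain ⟨h2, -, -, hgen, hπ2, -⟩ := hP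
  have hθ0 : θ ≠ 0 := ne_zero_of_sq_eq_natCast' hN hθ
  have hθ2 : θ ^ 2 = algebraMap ℚ D.H (N : ℚ) := sq_eq_algebraMap_of_sq_eq_natCast' hθ
  set P : EPoint D.H := D.yTrace θ with hPdef
  have hσ : ∀ s, (D.art s θ = θ ∧ D.act (D.art s) P = P) ∨ (D.art s θ = -θ ∧ D.act (D.art s) P = -P) := by
    intro s
    by_cases hs : s ∈ D.stabFinset θ
    · exact Or.inl ⟨(D.mem_stabFinset_iff s).mp hs, D.act_art_yTrace_of_mem h23 hs⟩
    · right
      have hne : D.art s θ ≠ θ := fun h => hs ((D.mem_stabFinset_iff s).mpr h)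
      refine ⟨(D.art_sq_eq_or_eq_neg hθ s).resolve_left hne, ?_⟩
      rw [hPdef, D.act_art_yTrace_of_not_mem hN hθ hn8 h3 h23 hπ hπ2 hs]
      obtain ⟨m, hm⟩ := heven
      rw [hm, ← two_mul, mul_nsmul, two_nsmul_ptZero, smul_zero, zero_sub]
  have hconj : D.conj θ = θ ∧ D.act D.conj P = P := ⟨hconjθ, D.act_conj_yTrace h2⟩
  let S : Subgroup (D.H ≃ₐ[ℚ] D.H) :=
    { carrier := {g | (g θ = θ ∧ D.act g P = P) ∨ (g θ = -θ ∧ D.act g P = -P)}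
      one_mem' := Or.inl ⟨rfl, D.act_one P⟩
      mul_mem' := by
        intro g h hg hh
        simp only [Set.mem_setOf_eq] at hg hh ⊢
        rw [AlgEquiv.mul_apply, D.act_mul]
        rcases hg with ⟨hgθ, hgP⟩ | ⟨hgθ, hgP⟩ <;> rcases hh with ⟨hhθ, hhP⟩ | ⟨hhθ, hhP⟩
        · exact Or.inl ⟨by rw [hhθ, hgθ], by rw [hhP, hgP]⟩
        · exact Or.inr ⟨by rw [hhθ, map_neg, hgθ], by rw [hhP, map_neg, hgP]⟩
        · exact Or.inr ⟨by rw [hhθ, hgθ], by rw [hhP, hgP]⟩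
        · exact Or.inl ⟨by rw [hhθ, map_neg, hgθ, neg_neg], by rw [hhP, map_neg, hgP, neg_neg]⟩
      inv_mem' := by
        intro g hg
        simp only [Set.mem_setOf_eq] at hg ⊢
        have hinvact : ∀ Q, D.act g⁻¹ (D.act g Q) = Q := fun Q => by
          rw [← D.act_mul, inv_mul_cancel, D.act_one]
        have hinvθ : ∀ x, g⁻¹ (g x) = x := fun x => by
          rw [← AlgEquiv.mul_apply, inv_mul_cancel, AlgEquiv.one_apply]
        rcases hg with ⟨hgθ, hgP⟩ | ⟨hgθ, hgP⟩
        · left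
          refine ⟨?_, ?_⟩
          · conv_lhs => rw [← hgθ]
            exact hinvθ θ
          · conv_lhs => rw [← hgP]
            exact hinvact P
        · right
          refine ⟨?_, ?_⟩
          · have := hinvθ θ
            rw [hgθ, map_neg] at this
            exact neg_eq_iff_eq_neg.mp this
          · have := hinvact P
            rw [hgP, map_neg] at this
            exact neg_eq_iff_eq_neg.mp this }
  have hall : ∀ g : D.H ≃ₐ[ℚ] D.H, g ∈ S := by
    intro g
    have hle : Subgroup.closure (Set.range D.art ∪ {D.conj}) ≤ S := by
      rw [Subgroup.closure_le]
      rintro σ (⟨s, rfl⟩ | hσ)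
      · exact hσ s
      · rw [Set.mem_singleton_iff] at hσ
        rw [hσ]; exact Or.inl hconj
    exact hle (hgen g)
  have hθne : θ ≠ -θ := D.sq_ne_neg_self hN hθ
  have hfix : ∀ g : D.H ≃ₐ[ℚ] D.H, g θ = θ →
      WeierstrassCurve.Affine.Point.map (W' := congruentNumberCurve 1) g.toAlgHom P = P := by
    intro g hg
    rcases hall g with ⟨-, h⟩ | ⟨hg', -⟩
    · exact h
    · exact absurd (hg.symm.trans hg') hθne
  have hneg : ∀ g : D.H ≃ₐ[ℚ] D.H, g θ = -θ →
      WeierstrassCurve.Affine.Point.map (W' := congruentNumberCurve 1) g.toAlgHom P = -P := by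
    intro g hg
    rcases hall g with ⟨hg', -⟩ | ⟨-, h⟩
    · exact absurd (hg'.symm.trans hg) hθne
    · exact h
  exact exists_transferEPos_eq_of_forall_gal N θ hθ2 hθ0 P hfix hneg

end Traces

/-! ## §1c `σ_{[ϖ]}(y₀) = (0, 0) − y₀` whenever `[ϖ] ∉ 2𝒜` and `#(2𝒜)` is odd (no index condition) -/

/-- **`σ_{[ϖ]}(y₀) = (0, 0) − y₀`** for `n ≡ 5 (mod 8)` (Thm. 2.4 (3) summand by summand, `#(2𝒜)` odd) — Lemma 4.3 (2),
(4.2) "`y₀ + y₀^{σ_ϖ} = #2𝒜·(0, 0)`". No index condition on `2𝒜` is needed for `s = [ϖ]` itself.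
[cite: Tian2014, Lemma 4.3 (2) (p0020 L35–L39) and its proof (p0020 L49–L52)] -/
theorem act_art_piClass_yZero (D : CMPointDataOne n) (hn8 : n % 8 = 5) (h3 : D.thm24_3) (h23 : D.def23)
    (hodd : Odd (Nat.card {a : ClassGroup (𝓞 (GenusField (2 * n))) // IsSquare a})) :
    D.act (D.art D.piClass) D.yZero = ptZero - D.yZero := by
  have h3' : ∀ t, D.z (D.piClass * t) = ptZero - D.z t := by
    intro t
    have := h3 t
    rw [if_pos hn8] at this
    rw [← this]; abel
  unfold yZero
  rw [map_sum, Finset.sum_congr rfl (fun t _ => h23 D.piClass t), Finset.sum_congr rfl (fun t _ => h3' t),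
    Finset.sum_sub_distrib, Finset.sum_const, card_filter_isSquare,
    CMPointData.odd_nsmul_of_two_nsmul_eq_zero two_nsmul_ptZero hodd]


/-! ## §2 `n = p₀p₁`: the stabilisers of `√p₀` and `√n`, their intersection `2𝒜`, and the relation (4.3) at `k = 1` -/

section TwoPrimes

variable (D : CMPointDataOne n) {θ₀ θ₁ : D.H} {p₀ p₁ : ℕ} (hp₀ : p₀ ≠ 0) (hp₁ : p₁ ≠ 0)
  (hθ₀ : θ₀ ^ 2 = (p₀ : D.H)) (hθ₁ : θ₁ ^ 2 = (p₁ : D.H))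
  (hgen : ∀ s, (D.art s θ₀ = θ₀ ∧ D.art s θ₁ = θ₁) ↔ IsSquare s)
  (hπ₀ : D.art D.piClass θ₀ = -θ₀) (hπ₁ : D.art D.piClass θ₁ = θ₁)
include hp₀ hp₁ hθ₀ hθ₁ hgen hπ₀ hπ₁

omit hp₀ hp₁ hθ₀ hθ₁ hπ₀ hπ₁ in
/-- A square fixes `√p₀` and `√n = √p₀√p₁` ("`2𝒜 ≅ Gal(H/H₀)`", `H₀ = K(√p₀, √p₁)`).
[cite: Tian2014, §4.1 (p0019 L46–L48), Lemma 4.3 proof (p0020 L52–L61)] -/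
theorem mem_stabFinsets_of_isSquare {s : ClassGroup (𝓞 (GenusField (2 * n)))} (hs : IsSquare s) :
    s ∈ D.stabFinset θ₀ ∧ s ∈ D.stabFinset (θ₀ * θ₁) := by
  obtain ⟨h0, h1⟩ := (hgen s).mpr hs
  exact ⟨(D.mem_stabFinset_iff s).mpr h0, (D.mem_stabFinset_iff s).mpr (by rw [map_mul, h0, h1])⟩

omit hp₁ hθ₁ hπ₀ hπ₁ in
/-- `B_{√p₀} ∩ B_{√n} = 2𝒜`: a class fixing `√p₀` and `√n` fixes `√p₁`, hence is a square.
[cite: Tian2014, §4.1 (p0019 L46–L48), Lemma 4.3 proof (p0020 L52–L61)] -/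
theorem isSquare_of_mem_stabFinsets {s : ClassGroup (𝓞 (GenusField (2 * n)))} (h0 : s ∈ D.stabFinset θ₀)
    (hn : s ∈ D.stabFinset (θ₀ * θ₁)) : IsSquare s := by
  rw [mem_stabFinset_iff] at h0 hn
  rw [map_mul, h0] at hn
  exact (hgen s).mp ⟨h0, mul_left_cancel₀ (ne_zero_of_sq_eq_natCast' hp₀ hθ₀) hn⟩

omit hp₁ in
/-- **`[ϖ]·(B_{√p₀} ∖ 2𝒜) ⊆ B_{√n} ∖ 2𝒜`**: a non-square fixing `√p₀` moves `√p₁`; after `[ϖ]` (which moves `√p₀`, fixes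
`√p₁`) both `√p₀`, `√p₁` are moved and `√n` is fixed. [cite: Tian2014, Lemma 4.3 proof (p0020 L52–L61)] -/
theorem piClass_mul_mem_stabFinset_mul_of_mem_not_isSquare {s : ClassGroup (𝓞 (GenusField (2 * n)))}
    (h0 : s ∈ D.stabFinset θ₀) (hs : ¬ IsSquare s) :
    D.piClass * s ∈ D.stabFinset (θ₀ * θ₁) ∧ ¬ IsSquare (D.piClass * s) := by
  rw [mem_stabFinset_iff] at h0
  have h1 : D.art s θ₁ = -θ₁ := by
    rcases D.art_sq_eq_or_eq_neg hθ₁ s with h | h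
    · exact absurd ((hgen s).mp ⟨h0, h⟩) hs
    · exact h
  refine ⟨?_, fun hsq => ?_⟩
  · rw [mem_stabFinset_iff, map_mul D.art, AlgEquiv.mul_apply, map_mul, h0, h1, map_mul, hπ₀, map_neg, hπ₁]
    ring
  · have := ((hgen _).mpr hsq).1
    rw [map_mul D.art, AlgEquiv.mul_apply, h0, hπ₀] at this
    exact D.sq_ne_neg_self hp₀ hθ₀ this.symm

/-- **`B_{√n} ∖ 2𝒜 ⊆ [ϖ]·(B_{√p₀} ∖ 2𝒜)`**: a non-square fixing `√n` moves both `√p₀` and `√p₁`; after `[ϖ]` it fixes `√p₀`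
and still moves `√p₁`. [cite: Tian2014, Lemma 4.3 proof (p0020 L52–L61)] -/
theorem exists_eq_piClass_mul_of_mem_stabFinset_mul_not_isSquare (hπ2 : D.piClass * D.piClass = 1)
    {s : ClassGroup (𝓞 (GenusField (2 * n)))} (hn : s ∈ D.stabFinset (θ₀ * θ₁)) (hs : ¬ IsSquare s) :
    D.piClass * s ∈ D.stabFinset θ₀ ∧ ¬ IsSquare (D.piClass * s) ∧ s = D.piClass * (D.piClass * s) := by
  rw [mem_stabFinset_iff, map_mul] at hn
  have h0 : D.art s θ₀ = -θ₀ := by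
    rcases D.art_sq_eq_or_eq_neg hθ₀ s with h | h
    · exfalso
      rw [h] at hn
      exact hs ((hgen s).mp ⟨h, mul_left_cancel₀ (ne_zero_of_sq_eq_natCast' hp₀ hθ₀) hn⟩)
    · exact h
  have h1 : D.art s θ₁ = -θ₁ := by
    rw [h0, neg_mul] at hn
    have := mul_left_cancel₀ (ne_zero_of_sq_eq_natCast' hp₀ hθ₀) (show θ₀ * -(D.art s θ₁) = θ₀ * θ₁ by
      rw [← hn]; ring)
    exact neg_eq_iff_eq_neg.mp this
  refine ⟨?_, fun hsq => ?_, by rw [← mul_assoc, hπ2, one_mul]⟩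
  · rw [mem_stabFinset_iff, map_mul D.art, AlgEquiv.mul_apply, h0, map_neg, hπ₀, neg_neg]
  · have := ((hgen _).mpr hsq).2
    rw [map_mul D.art, AlgEquiv.mul_apply, h1, map_neg, hπ₁] at this
    exact D.sq_ne_neg_self hp₁ hθ₁ this.symm

/-- **`B_{√n} ∖ 2𝒜 = [ϖ]·(B_{√p₀} ∖ 2𝒜)`** (as finsets). [cite: Tian2014, Lemma 4.3 proof (p0020 L52–L61)] -/
theorem stabFinset_mul_sdiff_eq_image (hπ2 : D.piClass * D.piClass = 1) :
    D.stabFinset (θ₀ * θ₁) \ (Finset.univ.filter fun t : ClassGroup (𝓞 (GenusField (2 * n))) => IsSquare t) =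
      (D.stabFinset θ₀ \ (Finset.univ.filter fun t : ClassGroup (𝓞 (GenusField (2 * n))) => IsSquare t)).image
        (fun t => D.piClass * t) := by
  ext x
  simp only [Finset.mem_sdiff, Finset.mem_filter, Finset.mem_univ, true_and, Finset.mem_image]
  constructor
  · rintro ⟨hx, hxs⟩
    obtain ⟨h0, hns, heq⟩ := D.exists_eq_piClass_mul_of_mem_stabFinset_mul_not_isSquare hp₀ hp₁ hθ₀ hθ₁ hgen hπ₀ hπ₁
      hπ2 hx hxs
    exact ⟨D.piClass * x, ⟨h0, hns⟩, heq.symm⟩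
  · rintro ⟨t, ⟨ht, hts⟩, rfl⟩
    exact D.piClass_mul_mem_stabFinset_mul_of_mem_not_isSquare hp₀ hθ₀ hθ₁ hgen hπ₀ hπ₁ ht hts

omit hp₁ hθ₁ hgen hπ₁ in
/-- `#B_{√p₀} = 2·#(2𝒜)` when `#𝒜 = 4·#(2𝒜)` (`[ϖ]` moves `√p₀`). [cite: Tian2014, Lemma 4.3 proof (p0020 L52–L58)] [cite: Cox2013, Prop. 3.11] -/
theorem card_stabFinset_eq_two_mul (hπ2 : D.piClass * D.piClass = 1)
    (hcard4 : Nat.card (ClassGroup (𝓞 (GenusField (2 * n)))) =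
      4 * Nat.card {a : ClassGroup (𝓞 (GenusField (2 * n))) // IsSquare a}) :
    (D.stabFinset θ₀).card = 2 * Nat.card {a : ClassGroup (𝓞 (GenusField (2 * n))) // IsSquare a} := by
  have h := D.natCard_eq_two_mul_card_stabFinset hp₀ hθ₀ hπ₀ hπ2
  omega

/-- **Tian's relation (4.3) at `k = 1`: `y_{p₀} + y_n = 2y₀ + (0, 0)`** (`n = p₀p₁`, `n ≡ 5 (mod 8)`): split both traces
along `2𝒜 ⊆ B`, pair the complementary coset of `B_{√p₀}` with that of `B_{√n}` through `[ϖ]` (Thm. 2.4 (3) gives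
`(0, 0)` per pair), and `#(B_{√p₀} ∖ 2𝒜) = #(2𝒜)` is odd. [cite: Tian2014, Lemma 4.3 (4.3) (p0020 L39–L44) and its proof (p0020 L45–p0021 L48)] -/
theorem yTrace_add_yTrace_mul_eq (hn8 : n % 8 = 5) (h3 : D.thm24_3) (hπ2 : D.piClass * D.piClass = 1)
    (hcard4 : Nat.card (ClassGroup (𝓞 (GenusField (2 * n)))) =
      4 * Nat.card {a : ClassGroup (𝓞 (GenusField (2 * n))) // IsSquare a})
    (hodd : Odd (Nat.card {a : ClassGroup (𝓞 (GenusField (2 * n))) // IsSquare a})) :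
    D.yTrace θ₀ + D.yTrace (θ₀ * θ₁) = (2 : ℕ) • D.yZero + ptZero := by
  set Sq : Finset (ClassGroup (𝓞 (GenusField (2 * n)))) :=
    Finset.univ.filter fun t : ClassGroup (𝓞 (GenusField (2 * n))) => IsSquare t with hSq
  have hsub0 : Sq ⊆ D.stabFinset θ₀ := fun s hs =>
    (D.mem_stabFinsets_of_isSquare hgen (Finset.mem_filter.mp hs).2).1
  have hsubn : Sq ⊆ D.stabFinset (θ₀ * θ₁) := fun s hs =>
    (D.mem_stabFinsets_of_isSquare hgen (Finset.mem_filter.mp hs).2).2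
  have h3' : ∀ t, D.z (D.piClass * t) = ptZero - D.z t := by
    intro t
    have := h3 t
    rw [if_pos hn8] at this
    rw [← this]; abel
  have hcardS : (D.stabFinset θ₀ \ Sq).card = Sq.card := by
    rw [Finset.card_sdiff_of_subset hsub0, D.card_stabFinset_eq_two_mul hp₀ hθ₀ hπ₀ hπ2 hcard4, hSq,
      card_filter_isSquare]
    omega
  have hoddS : Odd (D.stabFinset θ₀ \ Sq).card := by
    rw [hcardS, hSq, card_filter_isSquare]; exact hodd
  have e0 : D.yTrace θ₀ = ∑ s ∈ D.stabFinset θ₀ \ Sq, D.z s + ∑ s ∈ Sq, D.z s := by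
    unfold yTrace; rw [Finset.sum_sdiff hsub0]
  have en : D.yTrace (θ₀ * θ₁) = ∑ s ∈ D.stabFinset (θ₀ * θ₁) \ Sq, D.z s + ∑ s ∈ Sq, D.z s := by
    unfold yTrace; rw [Finset.sum_sdiff hsubn]
  have ecoset : ∑ s ∈ D.stabFinset (θ₀ * θ₁) \ Sq, D.z s =
      (D.stabFinset θ₀ \ Sq).card • ptZero - ∑ s ∈ D.stabFinset θ₀ \ Sq, D.z s := by
    rw [hSq, D.stabFinset_mul_sdiff_eq_image hp₀ hp₁ hθ₀ hθ₁ hgen hπ₀ hπ₁ hπ2,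
      Finset.sum_image (fun a _ b _ hab => mul_left_cancel hab), Finset.sum_congr rfl (fun t _ => h3' t),
      Finset.sum_sub_distrib, Finset.sum_const]
  rw [e0, en, ecoset, CMPointData.odd_nsmul_of_two_nsmul_eq_zero two_nsmul_ptZero hoddS]
  unfold yZero
  rw [← hSq, two_nsmul]
  abel

end TwoPrimes


/-! ## §3 `K = ℚ(√−2p₀p₁)`, `p₀ ≡ 5`, `p₁ ≡ 1 (mod 8)`, `(p₁/p₀) = −1`: `#𝒜[2] = 4` (Gauss) and `#(2𝒜)` odd (Tian's (1.1) at `k = 1`) -/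

section ClassGroupTwoPrimes

variable {p₀ p₁ : ℕ} (hp₀ : p₀.Prime) (hp₁ : p₁.Prime) (h₀5 : p₀ % 8 = 5) (h₁1 : p₁ % 8 = 1)
include hp₀ hp₁ h₀5 h₁1

/-- **`#𝒜[2] = 4` for `K = ℚ(√−2p₀p₁)`** (Gauss: `2^{t−1}` with `t = 3` ramified primes `2, p₀, p₁`).
[cite: Cox2013, Prop. 3.11] [cite: Tian2014, Lemma 5.1 proof (p. 28)] -/
theorem natCard_sq_eq_one_classGroup_genusField_two_mul_two_primes :
    Nat.card {c : ClassGroup (𝓞 (GenusField (2 * (p₀ * p₁)))) // c ^ 2 = 1} = 4 := by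
  have hne : p₀ ≠ p₁ := by omega
  have hp₀2 : p₀ ≠ 2 := by omega
  have hp₁2 : p₁ ≠ 2 := by omega
  have hd1 : 1 ≤ 2 * (p₀ * p₁) := by have := hp₀.two_le; have := hp₁.two_le; nlinarith
  obtain ⟨x, -, hx⟩ := exists_ringOfIntegers_sq_eq_neg (K := GenusField (2 * (p₀ * p₁))) (root_genusField_sq hd1)
  have hq : ∀ i, ((![2, p₀, p₁] : Fin 3 → ℕ) i).Prime := by
    intro i; fin_cases i
    · exact Nat.prime_two
    · exact hp₀
    · exact hp₁
  have hinj : Function.Injective (![2, p₀, p₁] : Fin 3 → ℕ) := by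
    intro i j hij
    fin_cases i <;> fin_cases j <;> simp_all
  have hprod : ∏ i, (![2, p₀, p₁] : Fin 3 → ℕ) i =
      if (2 * (p₀ * p₁)) % 4 = 1 then 2 * (2 * (p₀ * p₁)) else 2 * (p₀ * p₁) := by
    rw [if_neg (by omega), Fin.prod_univ_three]
    simp [mul_assoc]
  have := natCard_sq_eq_one_eq (finrank_genusField (2 * (p₀ * p₁))) hx hq hinj hprod
  simpa using this

omit hp₀ hp₁ in
/-- **The graph condition of Tian's Lemma 5.1 at `k = 1`** in Feng's kernel form: for `(p₁/p₀) = −1` (hence `(p₀/p₁) = −1`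
by quadratic reciprocity, `p₁ ≡ 1 (mod 4)`), Monsky's matrix `A = (1 1; 1 1)` has kernel `{0, (1, 1)}`.
[cite: Tian2014, Lemma 5.1 (p. 28, L2–L12)] [cite: HeathBrown1994SelmerCongruentII, Appendix (Monsky), typescript p. 39 L13–L26] -/
theorem legendreMatrix_two_primes_kernel (hj : jacobiSym (p₁ : ℤ) p₀ = -1) :
    ∀ v : Fin 2 → ZMod 2, legendreMatrix ![p₀, p₁] *ᵥ v = 0 → v = 0 ∨ v = fun _ => 1 := by
  have hj' : jacobiSym (p₀ : ℤ) p₁ = -1 := by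
    have h := jacobiSym.quadratic_reciprocity_one_mod_four (a := p₀) (b := p₁) (by omega)
      (Nat.odd_iff.mpr (by omega))
    rw [h]; exact hj
  have ha10 : addLegendreSym (p₁ : ℤ) p₀ = 1 := addLegendreSym_of_eq_neg_one hj
  have ha01 : addLegendreSym (p₀ : ℤ) p₁ = 1 := addLegendreSym_of_eq_neg_one hj'
  have hM : ∀ i j : Fin 2, legendreMatrix ![p₀, p₁] i j = 1 := by
    intro i j
    fin_cases i <;> fin_cases j <;>
      simp [legendreMatrix, Finset.sum_erase_eq_sub, Fin.sum_univ_two, ha10, ha01]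
  intro v hv
  have h0 := congr_fun hv 0
  simp only [Matrix.mulVec, dotProduct, Fin.sum_univ_two, hM, one_mul, Pi.zero_apply] at h0
  have hv01 : v 1 = v 0 := by
    have h2 : ∀ a b : ZMod 2, a + b = 0 → b = a := by decide
    exact h2 _ _ h0
  rcases (by decide : ∀ a : ZMod 2, a = 0 ∨ a = 1) (v 0) with h | h
  · left; funext i; revert i; rw [Fin.forall_fin_two]
    exact ⟨h, by rw [hv01]; exact h⟩
  · right; funext i; revert i; rw [Fin.forall_fin_two]
    exact ⟨h, by rw [hv01]; exact h⟩

/-- **`#(2𝒜)` is ODD for `K = ℚ(√−2p₀p₁)`, `p₀ ≡ 5`, `p₁ ≡ 1 (mod 8)`, `(p₁/p₀) = −1`** — Tian's condition (1.1) at `k = 1`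
("no order `4` elements, or equivalently `2𝒜` has odd cardinality"): the tree's `condition11_caseFive` (Lemma 5.1 ⇐ with
the graph condition; Rédei–Reichardt a tree theorem). [cite: Tian2014, §4.1 (p0019 L44–L48), Lemma 5.1 (p. 28)] [cite: LiMa2008, Thm. 0.4] -/
theorem odd_natCard_isSquare_classGroup_genusField_two_mul_two_primes (hj : jacobiSym (p₁ : ℤ) p₀ = -1) :
    Odd (Nat.card {a : ClassGroup (𝓞 (GenusField (2 * (p₀ * p₁)))) // IsSquare a}) := by
  have hd1 : 1 ≤ 2 * (p₀ * p₁) := by have := hp₀.two_le; have := hp₁.two_le; nlinarith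
  have hq : ∀ i, ((![p₀, p₁] : Fin 2 → ℕ) i).Prime := by
    intro i; fin_cases i
    · exact hp₀
    · exact hp₁
  have hinj : Function.Injective (![p₀, p₁] : Fin 2 → ℕ) := by
    have hne : p₀ ≠ p₁ := by omega
    intro i j hij
    fin_cases i <;> fin_cases j <;> simp_all
  have h50 : (![p₀, p₁] : Fin 2 → ℕ) 0 % 8 = 5 := h₀5
  have h1 : ∀ i : Fin 2, i ≠ 0 → (![p₀, p₁] : Fin 2 → ℕ) i % 8 = 1 := by
    intro i hi; fin_cases i
    · exact absurd rfl hi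
    · exact h₁1
  have hn : ∏ i, (![p₀, p₁] : Fin 2 → ℕ) i = p₀ * p₁ := by simp [Fin.prod_univ_two]
  have hK : IsQuadraticFieldOfSqrt (GenusField (2 * (p₀ * p₁))) (-(2 * (p₀ * p₁) : ℤ)) := by
    have h := isQuadraticFieldOfSqrt_genusField (d := 2 * (p₀ * p₁)) hd1
    have hc : (-((2 * (p₀ * p₁) : ℕ) : ℤ)) = -(2 * (p₀ * p₁) : ℤ) := by push_cast; ring
    rwa [hc] at h
  have hc11 := condition11_caseFive ![p₀, p₁] redeiReichardt_fourTwoCard_classGroup_holds hq hinj h50 h1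
    (legendreMatrix_two_primes_kernel h₀5 h₁1 hj) hn (GenusField (2 * (p₀ * p₁))) hK
  unfold Condition11 at hc11
  have hmod : (p₀ * p₁) % 8 = 5 := by rw [Nat.mul_mod, h₀5, h₁1]
  rw [if_pos (Or.inr hmod)] at hc11
  exact (odd_card_isSquare_iff_fourTwoCard_eq_one _).mpr hc11

/-- **`#𝒜 = 4·#(2𝒜)`** for `K = ℚ(√−2p₀p₁)` (`#𝒜 = #(2𝒜)·#𝒜[2]`, `#𝒜[2] = 4`). [cite: Tian2014, Lemma 5.1 proof (p. 28, L13–L16)] [cite: Cox2013, Prop. 3.11] -/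
theorem natCard_classGroup_genusField_two_mul_two_primes :
    Nat.card (ClassGroup (𝓞 (GenusField (2 * (p₀ * p₁))))) =
      4 * Nat.card {a : ClassGroup (𝓞 (GenusField (2 * (p₀ * p₁)))) // IsSquare a} := by
  rw [natCard_eq_card_isSquare_mul_card_sq_eq_one (ClassGroup (𝓞 (GenusField (2 * (p₀ * p₁))))),
    natCard_sq_eq_one_classGroup_genusField_two_mul_two_primes hp₀ hp₁ h₀5 h₁1, mul_comm]

end ClassGroupTwoPrimes


/-! ## §4 Tian Thm. 4.1 at `k = 1` on the data: `y_n ∉ 2E(ℚ(√n))⁻ + E[2]` from the printed skeleton and `hDiv` -/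

section DescentTwoPrimes

variable (D : CMPointDataOne n) {θ₀ θ₁ : D.H} {p₀ p₁ : ℕ}

/-- `(θ₀θ₁)² = n` when `n = p₀p₁`. [cite: Tian2014, (4.1) (p0019 L61)] [folklore] -/
theorem mul_sq_eq_natCast_of_eq (hn : n = p₀ * p₁) (hθ₀ : θ₀ ^ 2 = (p₀ : D.H)) (hθ₁ : θ₁ ^ 2 = (p₁ : D.H)) :
    (θ₀ * θ₁) ^ 2 = (n : D.H) := by
  rw [mul_sq_eq_natCast hθ₀ hθ₁]
  exact congrArg (fun m : ℕ => (m : D.H)) hn.symm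

/-- **Tian Thm. 4.1 at `k = 1` (= Monsky Thm. 3.9 (5), `p₁p₅` with `(p₁/p₅) = −1`), the descent step on the data**: for
`n = p₀p₁ ≡ 5 (mod 8)` square-free, a system `D` with the printed properties, square roots `θ₀ = √p₀`, `θ₁ = √p₁ ∈ H`
fixed by complex conjugation with "`σ_s` fixes both ⟺ `s ∈ 2𝒜`" (`2𝒜 ≅ Gal(H/H₀)`), "`σ_ϖ√p₀ = −√p₀`, `σ_ϖ√p₁ = √p₁`",
"`i ∉ H`", the kernel inputs `#𝒜 = 4·#(2𝒜)` and `#(2𝒜)` odd, and Tian's printed divisibility sentence for the smaller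
trace `hDiv : y_{p₀} ∈ 2E(ℚ(√p₀))⁻ + E[2]` (the consequence of Thm. 3.3 — the ONE analytic input): the trace `y_n` is
the transfer along `√n` of a rational point `y″ ∈ E_n(ℚ)` (Lemma 4.3 (1)), and `y″ ∉ 2E_n(ℚ) + E_n(ℚ)_tor`. Proof as
printed: if `y_n = 2S + T`, relation (4.3) gives `2(y₀ − S − S′) = T + T′ − (0,0) ∈ E[2]`, so `Q := y₀ − S − S′` is
`4`-torsion, hence `2`-torsion (`E(H)[4] = E[2]`) and rational; `σ_{[ϖ]}` negates `S`, `S′` (it moves `√n`, `√p₀`), fixes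
`Q` and sends `y₀` to `(0, 0) − y₀` — whence `(0, 0) = 2Q = 0`.
[cite: Tian2014, Thm. 4.1 (p0019 L65–L70) and its proof (p0021 L49–p0022 L20), Lemma 4.3 (p0020 L31–L44)]
[cite: Monsky1990MockHeegner, Thm. 3.9 (5) (p. 55), Cor. 5.15 (3) (p. 66)] -/
theorem exists_transferAlong_eq_yTrace_mul_not_two_smul_add_torsion (hn : n = p₀ * p₁) (hp₀ : p₀ ≠ 0)
    (hp₁ : p₁ ≠ 0) (hsq : Squarefree n) (hn8 : n % 8 = 5) (hP : D.Printed)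
    (hθ₀ : θ₀ ^ 2 = (p₀ : D.H)) (hθ₁ : θ₁ ^ 2 = (p₁ : D.H)) (hconj₀ : D.conj θ₀ = θ₀) (hconj₁ : D.conj θ₁ = θ₁)
    (hgen : ∀ s, (D.art s θ₀ = θ₀ ∧ D.art s θ₁ = θ₁) ↔ IsSquare s)
    (hπ₀ : D.art D.piClass θ₀ = -θ₀) (hπ₁ : D.art D.piClass θ₁ = θ₁) (hnoI : ∀ x : D.H, x ^ 2 ≠ -1)
    (hcard4 : Nat.card (ClassGroup (𝓞 (GenusField (2 * n)))) =
      4 * Nat.card {a : ClassGroup (𝓞 (GenusField (2 * n))) // IsSquare a})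
    (hodd : Odd (Nat.card {a : ClassGroup (𝓞 (GenusField (2 * n))) // IsSquare a}))
    (hDiv : ∃ (w : (congruentNumberCurve p₀).toAffine.Point) (T' : EPoint D.H), (2 : ℕ) • T' = 0 ∧
      D.yTrace θ₀ = D.transferAlong p₀ hp₀ hθ₀ ((2 : ℕ) • w) + T') :
    ∃ y' : (congruentNumberCurve n).toAffine.Point,
      D.transferAlong n hsq.ne_zero (D.mul_sq_eq_natCast_of_eq hn hθ₀ hθ₁) y' = D.yTrace (θ₀ * θ₁) ∧
      ∀ z t : (congruentNumberCurve n).toAffine.Point, IsOfFinAddOrder t → y' ≠ (2 : ℤ) • z + t := by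
  have hn0 : n ≠ 0 := hsq.ne_zero
  have hθn : (θ₀ * θ₁) ^ 2 = (n : D.H) := D.mul_sq_eq_natCast_of_eq hn hθ₀ hθ₁
  obtain ⟨h2, h3, h23, hgenG, hπ2, hπ1⟩ := hP
  have hπn : D.art D.piClass (θ₀ * θ₁) = -(θ₀ * θ₁) := by rw [map_mul, hπ₀, hπ₁]; ring
  have hconjn : D.conj (θ₀ * θ₁) = θ₀ * θ₁ := by rw [map_mul, hconj₀, hconj₁]
  -- `#B_{√n} = 2·#(2𝒜)` is even
  have heven : Even (D.stabFinset (θ₀ * θ₁)).card := by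
    have h := D.natCard_eq_two_mul_card_stabFinset hn0 hθn hπn hπ2
    exact ⟨Nat.card {a : ClassGroup (𝓞 (GenusField (2 * n))) // IsSquare a}, by omega⟩
  -- Lemma 4.3 (1): `y_n ∈ E(ℚ(√n))⁻`
  obtain ⟨y', hy'⟩ := D.exists_transferAlong_eq_yTrace hn0 hθn hn8 h3 h23 hπn
    ⟨h2, h3, h23, hgenG, hπ2, hπ1⟩ hconjn heven
  refine ⟨y', hy', ?_⟩
  intro z t ht heq
  obtain ⟨w, T', hT'2, hyP0⟩ := hDiv
  have ht2 : (2 : ℕ) • t = 0 := two_nsmul_eq_zero_of_isOfFinAddOrder_congruentNumberCurve hsq ht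
  set S : EPoint D.H := D.transferAlong n hn0 hθn z with hS
  set T : EPoint D.H := D.transferAlong n hn0 hθn t with hT
  set S' : EPoint D.H := D.transferAlong p₀ hp₀ hθ₀ w with hS'
  have hyn : D.yTrace (θ₀ * θ₁) = (2 : ℕ) • S + T := by
    rw [← hy', heq, map_add, map_zsmul, two_zsmul, two_nsmul]
  have hyP0' : D.yTrace θ₀ = (2 : ℕ) • S' + T' := by rw [hyP0, map_nsmul]
  have hT2 : (2 : ℕ) • T = 0 := by rw [hT, ← map_nsmul, ht2, map_zero]
  -- relation (4.3)
  have h43 := D.yTrace_add_yTrace_mul_eq hp₀ hp₁ hθ₀ hθ₁ hgen hπ₀ hπ₁ hn8 h3 hπ2 hcard4 hodd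
  rw [hyP0', hyn] at h43
  set Q : EPoint D.H := D.yZero - S - S' with hQdef
  have h2Q : (2 : ℕ) • Q = T' + T - ptZero := by
    rw [hQdef, smul_sub, smul_sub]
    have : (2 : ℕ) • D.yZero = (2 : ℕ) • S' + T' + ((2 : ℕ) • S + T) - ptZero := by
      rw [h43]; abel
    rw [this]; abel
  have h4Q : (2 : ℕ) • ((2 : ℕ) • Q) = 0 := by
    rw [h2Q, smul_sub, smul_add, hT'2, hT2, two_nsmul_ptZero]; abel
  -- `E(H)[4] = E[2]`
  have htwo : ∀ s : D.H, s ^ 2 ≠ 2 := D.sq_ne_two_of_sq_ne_neg_one hn0 hθn hnoI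
  have h2Q0 : (2 : ℕ) • Q = 0 :=
    two_nsmul_eq_zero_of_two_nsmul_two_nsmul_eq_zero_of_no_sqrt hnoI htwo Q h4Q
  -- `σ_{[ϖ]}` on the pieces
  have hSπ : D.act (D.art D.piClass) S = -S := by
    rw [hS]; exact act_transferEPos_of_neg n (θ₀ * θ₁) _ _ _ hπn z
  have hS'π : D.act (D.art D.piClass) S' = -S' := by
    rw [hS']; exact act_transferEPos_of_neg p₀ θ₀ _ _ _ hπ₀ w
  have hQπ : D.act (D.art D.piClass) Q = Q := by
    have := map_sub_self_eq_zero_of_two_nsmul_eq_zero (D.art D.piClass) Q h2Q0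
    rw [sub_eq_zero] at this
    exact this
  have hyπ := D.act_art_piClass_yZero hn8 h3 h23 hodd
  have hy0 : D.yZero = Q + S + S' := by rw [hQdef]; abel
  rw [hy0, map_add, map_add, hSπ, hS'π, hQπ] at hyπ
  have hcontra : (ptZero : EPoint D.H) = (2 : ℕ) • Q := by
    rw [two_nsmul]
    calc (ptZero : EPoint D.H) = (ptZero - (Q + S + S')) + (Q + S + S') := by abel
      _ = (Q + -S + -S') + (Q + S + S') := by rw [hyπ]
      _ = Q + Q := by abel
  rw [h2Q0] at hcontra
  exact WeierstrassCurve.Affine.Point.some_ne_zero _ hcontra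

/-- **Tian Thm. 4.1 at `k = 1` for `n = p₀p₁`, `p₀ ≡ 5`, `p₁ ≡ 1 (mod 8)` primes with `(p₁/p₀) = −1`** (Monsky's Cor. 5.15 (3)
«`p₁p₅` when `(p₁/p₅) = −1`»): the kernel inputs `#𝒜[2] = 4` and `#(2𝒜)` odd discharged (Gauss; Rédei–Reichardt with the
graph condition at `k = 1`). [cite: Tian2014, Thm. 4.1 (p0019 L65–L70), Lemma 5.1 (p. 28)] [cite: Monsky1990MockHeegner, Thm. 3.9 (5) (p. 55), Cor. 5.15 (3) (p. 66)] -/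
theorem exists_transferAlong_eq_yTrace_mul_not_two_smul_add_torsion_two_primes (hn : n = p₀ * p₁)
    (hp₀ : p₀.Prime) (hp₁ : p₁.Prime) (h₀5 : p₀ % 8 = 5) (h₁1 : p₁ % 8 = 1) (hj : jacobiSym (p₁ : ℤ) p₀ = -1)
    (hP : D.Printed)
    (hθ₀ : θ₀ ^ 2 = (p₀ : D.H)) (hθ₁ : θ₁ ^ 2 = (p₁ : D.H)) (hconj₀ : D.conj θ₀ = θ₀) (hconj₁ : D.conj θ₁ = θ₁)
    (hgen : ∀ s, (D.art s θ₀ = θ₀ ∧ D.art s θ₁ = θ₁) ↔ IsSquare s)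
    (hπ₀ : D.art D.piClass θ₀ = -θ₀) (hπ₁ : D.art D.piClass θ₁ = θ₁) (hnoI : ∀ x : D.H, x ^ 2 ≠ -1)
    (hDiv : ∃ (w : (congruentNumberCurve p₀).toAffine.Point) (T' : EPoint D.H), (2 : ℕ) • T' = 0 ∧
      D.yTrace θ₀ = D.transferAlong p₀ hp₀.ne_zero hθ₀ ((2 : ℕ) • w) + T') :
    ∃ y' : (congruentNumberCurve n).toAffine.Point,
      D.transferAlong n (by rw [hn]; exact Nat.mul_ne_zero hp₀.ne_zero hp₁.ne_zero)
        (D.mul_sq_eq_natCast_of_eq hn hθ₀ hθ₁) y' = D.yTrace (θ₀ * θ₁) ∧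
      ∀ z t : (congruentNumberCurve n).toAffine.Point, IsOfFinAddOrder t → y' ≠ (2 : ℤ) • z + t := by
  have hsq : Squarefree n := by
    rw [hn]
    exact (Nat.squarefree_mul ((Nat.coprime_primes hp₀ hp₁).mpr (by omega))).mpr
      ⟨hp₀.prime.squarefree, hp₁.prime.squarefree⟩
  have hn8 : n % 8 = 5 := by rw [hn, Nat.mul_mod, h₀5, h₁1]
  have hcard4 : Nat.card (ClassGroup (𝓞 (GenusField (2 * n)))) =
      4 * Nat.card {a : ClassGroup (𝓞 (GenusField (2 * n))) // IsSquare a} := by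
    subst hn; exact natCard_classGroup_genusField_two_mul_two_primes hp₀ hp₁ h₀5 h₁1
  have hodd : Odd (Nat.card {a : ClassGroup (𝓞 (GenusField (2 * n))) // IsSquare a}) := by
    subst hn; exact odd_natCard_isSquare_classGroup_genusField_two_mul_two_primes hp₀ hp₁ h₀5 h₁1 hj
  exact D.exists_transferAlong_eq_yTrace_mul_not_two_smul_add_torsion hn hp₀.ne_zero hp₁.ne_zero hsq hn8 hP hθ₀ hθ₁
    hconj₀ hconj₁ hgen hπ₀ hπ₁ hnoI hcard4 hodd hDiv

end DescentTwoPrimes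


end CMPointDataOne

end Literature.NumberTheory.EllipticCurves.Tian2014

end
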